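import Summits.Ventures.CertifiedQuantumChemistry.Rows.PencilBlockCertificate
import Literature.Computation.Certificates.PosSemidefInt
import HarnessLib

/-!
# Ventures/CertifiedQuantumChemistry — Rows/PencilBlockCertificateRat.lean: a STRUCTURED, RATIONAL one-block pencil certificate —
# `X(ε) = X₀ + εX₁ + ε²X₂ ⪰ 0` for `0 < ε ≤ ε₀` from the kernel of `X₀`, an INTEGER rounded Gram certificate of the margin, and
# row sums (the per-block engine for the `L = 6` lift; companion of `Rows/PencilBlockCertificate.lean`)

HONEST FRAMING (verbatim): certified bounds for a stated model Hamiltonian in a stated basis; not a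
claim about the real molecule beyond that model. A CERTIFICATE FORMAT: no model, no row, no claim node, no value of record.

Seat rdm-B (gen 42; `tools/x14-g42/l6/MEMO-L6-KERNEL-FLOOR.md` §3). Gen 41's `Rows/PencilBlockCertificate.lean` certifies a
polynomial block `X(η², δ)` through GENERIC congruences `T0ᵀ X_jk T0` and exact `LDLᵀ` factor tables over `ℚ(√2)` — fine at
dimension `≤ 32`, infeasible for the 72-dimensional blocks of the `L = 6` lift (`d³` pair products, factor entries of thousands of
bits). This file types the STRUCTURED variant measured there: the block family is `X(ε) = X₀ + εX₁ + ε²X₂` with RATIONAL tables;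
the congruence basis is `T(ε) = [e_c (c not free) | w_c/ε (c free)]` where the `w_c` (`c` free) span `ker X₀` and carry the identity
pattern on the free coordinates (an RREF kernel basis), so that `T(ε) = (1 + N)·D_ε` with `N² = 0` and the EXPLICIT inverse
`D_ε⁻¹(1 − N)` — no inverse table, no generic product; the pencil `P(ε) = T(ε)ᵀX(ε)T(ε) = L + εR₁ + ε²R₂` is given by STRUCTURED
formulas (`L = [[X₀^VV, (X₁w)^V],[·, wᵀX₂w]]`, `R₁ = [[X₁^VV, (X₂w)^V],[·, 0]]`, `R₂ = [[X₂^VV, 0],[0, 0]]`, kernel cost `O(d²·#free)`)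
under the decidable polynomiality conditions `X₀w = 0`, `wᵀX₁w' = 0`; the margin `L − μ·Π ⪰ 0` (`Π` = the live coordinates; dead
= forced kernel directions, whose rows vanish in `L, R₁, R₂`) comes from an INTEGER ROUNDED GRAM CERTIFICATE
(`Literature/Computation/Certificates/PosSemidefInt.lean`: `IsGramCertZ`, Gershgorin on the integer residual — row-splittable
`decide`s, measured 139 s for the 72-dimensional `G_0` block of the `L = 6` lift); then `Rows/DominantPencilPSD` /
`PencilBlock.posSemidef_of_dominant_mask` give `P(ε) ⪰ 0` for `ε·(ρ₁ + ρ₂) ≤ μ`, and `X(ε) = Sᵀ P(ε) S` with `S = T(ε)⁻¹`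
explicit gives **`realXQ_posSemidef`**. 0 sorry; small `def`s (the structured tables and maps); standard axioms. References
(docstring-only): R. A. Horn, C. R. Johnson, Matrix Analysis (2nd ed.) Thm 6.1.10 (Gershgorin / diagonal dominance), Obs. 7.1.8.
-/

set_option linter.style.longLine false

namespace Summit.Ventures.CertifiedQuantumChemistry

namespace PencilRat

open Matrix Finset DominantPencil PencilBlock
open Literature.Computation.Certificates.PSD

variable {d : ℕ}

/-! ## §1 The structured data and the pencil tables -/

/-- `(X·w_c)_i = Σ_k X[i,k]·W[c,k]` — a block table applied to the kernel column of the free coordinate `c`. -/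
def xw (X : Fin d → Fin d → ℚ) (W : Fin d → Fin d → ℚ) (c i : Fin d) : ℚ := ∑ k, X i k * W c k

/-- `w_cᵀ·X·w_c' = Σ_i W[c,i]·(X·w_c')_i`. -/
def wxw (X : Fin d → Fin d → ℚ) (W : Fin d → Fin d → ℚ) (c c' : Fin d) : ℚ := ∑ i, W c i * xw X W c' i

/-- The pencil's constant term `L`: `X₀` on non-free × non-free, `X₁w` on the mixed part, `wᵀX₂w` on free × free. -/
def pL (X : Fin 3 → Fin d → Fin d → ℚ) (fr : Fin d → Bool) (W : Fin d → Fin d → ℚ) (i i' : Fin d) : ℚ :=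
  if fr i then (if fr i' then wxw (X 2) W i i' else xw (X 1) W i i')
  else (if fr i' then xw (X 1) W i' i else X 0 i i')

/-- The pencil's `ε¹` term `R₁`: `X₁` on non-free × non-free, `X₂w` on the mixed part, `0` on free × free. -/
def pR1 (X : Fin 3 → Fin d → Fin d → ℚ) (fr : Fin d → Bool) (W : Fin d → Fin d → ℚ) (i i' : Fin d) : ℚ :=
  if fr i then (if fr i' then 0 else xw (X 2) W i i')
  else (if fr i' then xw (X 2) W i' i else X 1 i i')

/-- The pencil's `ε²` term `R₂`: `X₂` on non-free × non-free, `0` elsewhere. -/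
def pR2 (X : Fin 3 → Fin d → Fin d → ℚ) (fr : Fin d → Bool) (i i' : Fin d) : ℚ :=
  if fr i then 0 else (if fr i' then 0 else X 2 i i')

/-- The real block family `X(ε) = X₀ + ε X₁ + ε² X₂`. -/
noncomputable def realXQ (X : Fin 3 → Fin d → Fin d → ℚ) (ε : ℝ) : Matrix (Fin d) (Fin d) ℝ :=
  ∑ j : Fin 3, (ε ^ (j : ℕ)) • (Matrix.of fun i i' => ((X j i i' : ℚ) : ℝ))

/-- The congruence basis `T(ε)`: column `c` is `w_c/ε` for a free coordinate, the unit vector `e_c` otherwise. -/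
noncomputable def tMat (fr : Fin d → Bool) (W : Fin d → Fin d → ℚ) (ε : ℝ) : Matrix (Fin d) (Fin d) ℝ :=
  Matrix.of fun i c => if fr c then ((W c i : ℚ) : ℝ) / ε else (if i = c then 1 else 0)

/-- The explicit inverse `S(ε) = D_ε⁻¹ (1 − N)`: row `i` scaled by `ε` if `i` is free; `N[i,c] = W[c,i]` for `c` free, `i` not free. -/
noncomputable def sMat (fr : Fin d → Bool) (W : Fin d → Fin d → ℚ) (ε : ℝ) : Matrix (Fin d) (Fin d) ℝ :=
  Matrix.of fun i c => (if fr i then ε else 1) *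
    ((if i = c then 1 else 0) - (if fr c ∧ ¬ (fr i) then ((W c i : ℚ) : ℝ) else 0))

/-! ## §2 `T(ε)·S(ε) = 1` (the identity pattern of the kernel columns on the free coordinates; `N² = 0`) -/

/-- With the identity pattern `W[c,c'] = [c = c']` on free coordinates, `T(ε)·S(ε) = 1` for `ε ≠ 0`. -/
theorem tMat_mul_sMat (fr : Fin d → Bool) (W : Fin d → Fin d → ℚ)
    (hW : ∀ c c', fr c = true → fr c' = true → W c c' = if c = c' then 1 else 0) {ε : ℝ} (hε : ε ≠ 0) :
    tMat fr W ε * sMat fr W ε = 1 := by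
  ext i c
  simp only [tMat, sMat, Matrix.mul_apply, Matrix.of_apply, Matrix.one_apply]
  -- split the sum over k into free and non-free k
  have key : ∀ k : Fin d, (if fr k then ((W k i : ℚ) : ℝ) / ε else (if i = k then 1 else 0)) *
      ((if fr k then ε else 1) * ((if k = c then 1 else 0) - (if fr c ∧ ¬ (fr k) then ((W c k : ℚ) : ℝ) else 0))) =
      (if fr k then ((W k i : ℚ) : ℝ) * (if k = c then 1 else 0) else
        (if i = k then 1 else 0) * ((if k = c then 1 else 0) - (if fr c then ((W c k : ℚ) : ℝ) else 0))) := by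
    intro k
    by_cases hk : fr k
    · simp only [hk, if_true, not_true_eq_false, and_false, if_false, sub_zero]
      field_simp
    · simp only [hk, if_false, Bool.false_eq_true, not_false_eq_true, and_true, one_mul]
  simp_rw [key]
  by_cases hc : fr c
  · -- column c free: Σ_k [fr k] W k i [k=c] + Σ_k [¬fr k][i=k]([k=c] − W c k)
    simp only [hc, if_true]
    rw [← Finset.add_sum_erase _ _ (Finset.mem_univ c)]
    simp only [if_true, mul_one, hc]
    by_cases hi : fr i
    · -- i free: W c i = [c = i]; the remaining sum vanishes (k ≠ c: free k gives W k i [k=c]=0; non-free k gives [i=k]=0 since i free)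
      have hrest : ∑ k ∈ Finset.univ.erase c, (if fr k then ((W k i : ℚ) : ℝ) * (if k = c then 1 else 0) else
          (if i = k then 1 else 0) * ((if k = c then 1 else 0) - ((W c k : ℚ) : ℝ))) = 0 := by
        refine Finset.sum_eq_zero fun k hk => ?_
        have hkc : k ≠ c := (Finset.mem_erase.1 hk).1
        by_cases hfk : fr k
        · simp [hfk, hkc]
        · have hik : i ≠ k := fun h => by subst h; exact hfk hi
          simp [hfk, hik]
      rw [hrest, add_zero, hW c i hc hi]
      by_cases hci : c = i
      · subst hci; simp
      · have hic : ¬ i = c := fun h => hci h.symm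
        simp [hci, hic]
    · -- i not free: W c i·1 + (from k = i, non-free): ([i = c] − W c i) ; i ≠ c since c free
      have hic : i ≠ c := fun h => by subst h; exact hi hc
      rw [Finset.sum_eq_single_of_mem i (Finset.mem_erase.2 ⟨hic, Finset.mem_univ i⟩) (fun k hk hki => ?_)]
      · simp [hi, hic]
      · by_cases hfk : fr k
        · have hkc : k ≠ c := (Finset.mem_erase.1 hk).1
          simp [hfk, hkc]
        · have hik : ¬ i = k := fun h => hki h.symm
          simp [hfk, hik]
  · -- column c not free: Σ_k [fr k] W k i [k = c] (= 0 since k = c would be free) + Σ_k [¬fr k][i=k][k=c]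
    simp only [hc]
    rw [Finset.sum_eq_single_of_mem c (Finset.mem_univ c) (fun k _ hkc => ?_)]
    · simp [hc]
    · by_cases hfk : fr k <;> simp [hfk, hkc]

/-! ## §3 The structured congruence: `T(ε)ᵀ X(ε) T(ε) = L + ε R₁ + ε² R₂` -/

/-- Real versions of the structured tables. -/
noncomputable def realQ (M : Fin d → Fin d → ℚ) : Matrix (Fin d) (Fin d) ℝ := Matrix.of fun i i' => ((M i i' : ℚ) : ℝ)

/-- Entries of `X(ε)`. -/
theorem realXQ_apply (X : Fin 3 → Fin d → Fin d → ℚ) (ε : ℝ) (i k : Fin d) :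
    realXQ X ε i k = ((X 0 i k : ℚ) : ℝ) + ε * ((X 1 i k : ℚ) : ℝ) + ε ^ 2 * ((X 2 i k : ℚ) : ℝ) := by
  simp only [realXQ, Matrix.sum_apply, Matrix.smul_apply, Matrix.of_apply, smul_eq_mul, Fin.sum_univ_three, Fin.isValue,
    Fin.val_zero, Fin.val_one, Fin.val_two, pow_zero, one_mul, pow_one]

/-- **THE STRUCTURED CONGRUENCE.** Under the polynomiality conditions `X₀·w_c = 0` and `w_cᵀ·X₁·w_c' = 0` (free `c, c'`),
`T(ε)ᵀ X(ε) T(ε) = L + ε R₁ + ε² R₂` for `ε ≠ 0`. -/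
theorem congruence_eq (X : Fin 3 → Fin d → Fin d → ℚ) (fr : Fin d → Bool) (W : Fin d → Fin d → ℚ)
    (h0 : ∀ c i, fr c = true → xw (X 0) W c i = 0) (h1 : ∀ c c', fr c = true → fr c' = true → wxw (X 1) W c c' = 0)
    (hX0 : ∀ i k, X 0 i k = X 0 k i) (hX1 : ∀ i k, X 1 i k = X 1 k i) (hX2 : ∀ i k, X 2 i k = X 2 k i)
    {ε : ℝ} (hε : ε ≠ 0) :
    (tMat fr W ε)ᵀ * realXQ X ε * tMat fr W ε = realQ (pL X fr W) + ε • realQ (pR1 X fr W) + ε ^ 2 • realQ (pR2 X fr) := by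
  ext c c'
  -- generic entry: Σ_k (Σ_i T i c · X(ε) i k) · T k c'
  simp only [Matrix.mul_apply, Matrix.transpose_apply, Matrix.add_apply, Matrix.smul_apply, smul_eq_mul, realQ, Matrix.of_apply,
    tMat, realXQ_apply]
  -- real versions of the table operations
  have exw : ∀ (M : Fin d → Fin d → ℚ) (a i : Fin d), ((xw M W a i : ℚ) : ℝ) = ∑ k, ((M i k : ℚ) : ℝ) * ((W a k : ℚ) : ℝ) := by
    intro M a i; simp only [xw]; push_cast; rfl
  have ewxw : ∀ (M : Fin d → Fin d → ℚ) (a a' : Fin d), ((wxw M W a a' : ℚ) : ℝ) = ∑ i, ((W a i : ℚ) : ℝ) * ((xw M W a' i : ℚ) : ℝ) := by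
    intro M a a'; simp only [wxw]; push_cast; rfl
  by_cases hc : fr c <;> by_cases hc' : fr c'
  · -- free × free: (1/ε²) Σ_k Σ_i W c i X(ε) i k W c' k = wᵀX₂w' + (wᵀX₀w')/ε² + (wᵀX₁w')/ε, the last two vanish
    simp only [hc, hc', if_true, pL, pR1, pR2, Rat.cast_zero, mul_zero, add_zero]
    have hw0 : ∀ i, ∑ k, ((X 0 i k : ℚ) : ℝ) * ((W c' k : ℚ) : ℝ) = 0 := fun i => by
      rw [← exw]; exact_mod_cast h0 c' i hc'
    have hw1 : ∑ i, ((W c i : ℚ) : ℝ) * ∑ k, ((X 1 i k : ℚ) : ℝ) * ((W c' k : ℚ) : ℝ) = 0 := by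
      have := h1 c c' hc hc'
      rw [wxw] at this
      have e : (((∑ i, W c i * xw (X 1) W c' i : ℚ)) : ℝ) = 0 := by exact_mod_cast this
      simp only [Rat.cast_sum, Rat.cast_mul, exw] at e
      exact e
    rw [ewxw]
    simp only [exw]
    -- expand and regroup
    have e1 : ∀ k, (∑ i, ((W c i : ℚ) : ℝ) / ε * (((X 0 i k : ℚ) : ℝ) + ε * ((X 1 i k : ℚ) : ℝ) + ε ^ 2 * ((X 2 i k : ℚ) : ℝ))) *
        (((W c' k : ℚ) : ℝ) / ε) =
        ∑ i, ((W c i : ℚ) : ℝ) * ((W c' k : ℚ) : ℝ) * (((X 0 i k : ℚ) : ℝ) / ε ^ 2 + ((X 1 i k : ℚ) : ℝ) / ε + ((X 2 i k : ℚ) : ℝ)) := by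
      intro k; rw [Finset.sum_mul]; refine Finset.sum_congr rfl fun i _ => ?_; field_simp
    simp_rw [e1]
    rw [Finset.sum_comm]
    -- now Σ_i Σ_k W c i W c' k (X0/ε² + X1/ε + X2)
    have e2 : ∀ i, ∑ k, ((W c i : ℚ) : ℝ) * ((W c' k : ℚ) : ℝ) * (((X 0 i k : ℚ) : ℝ) / ε ^ 2 + ((X 1 i k : ℚ) : ℝ) / ε + ((X 2 i k : ℚ) : ℝ)) =
        ((W c i : ℚ) : ℝ) * ((∑ k, ((X 0 i k : ℚ) : ℝ) * ((W c' k : ℚ) : ℝ)) / ε ^ 2 +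
          (∑ k, ((X 1 i k : ℚ) : ℝ) * ((W c' k : ℚ) : ℝ)) / ε + ∑ k, ((X 2 i k : ℚ) : ℝ) * ((W c' k : ℚ) : ℝ)) := by
      intro i; rw [Finset.sum_div, Finset.sum_div, ← Finset.sum_add_distrib, ← Finset.sum_add_distrib, Finset.mul_sum]
      refine Finset.sum_congr rfl fun k _ => ?_; ring
    simp_rw [e2, hw0, zero_div, zero_add, mul_add, Finset.sum_add_distrib]
    rw [show ∑ i, ((W c i : ℚ) : ℝ) * ((∑ k, ((X 1 i k : ℚ) : ℝ) * ((W c' k : ℚ) : ℝ)) / ε) =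
      (∑ i, ((W c i : ℚ) : ℝ) * ∑ k, ((X 1 i k : ℚ) : ℝ) * ((W c' k : ℚ) : ℝ)) / ε by
        rw [Finset.sum_div]; refine Finset.sum_congr rfl fun i _ => ?_; ring]
    rw [hw1, zero_div, zero_add]
  · -- free × non-free: (1/ε) Σ_i W c i X(ε) i c' = (X₁w)_c' ... using symmetry X i c' = X c' i
    simp only [hc, hc', if_true, if_false, Bool.false_eq_true, pL, pR1, pR2, Rat.cast_zero, mul_zero, add_zero]
    rw [Finset.sum_eq_single_of_mem c' (Finset.mem_univ _) (fun k _ hk => by simp [hk])]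
    simp only [if_true, mul_one]
    rw [exw, exw]
    have hw0 : ∑ k, ((X 0 c' k : ℚ) : ℝ) * ((W c k : ℚ) : ℝ) = 0 := by rw [← exw]; exact_mod_cast h0 c c' hc
    have e1 : ∀ i, ((W c i : ℚ) : ℝ) / ε * (((X 0 i c' : ℚ) : ℝ) + ε * ((X 1 i c' : ℚ) : ℝ) + ε ^ 2 * ((X 2 i c' : ℚ) : ℝ)) =
        (((X 0 c' i : ℚ) : ℝ) * ((W c i : ℚ) : ℝ)) / ε + ((X 1 c' i : ℚ) : ℝ) * ((W c i : ℚ) : ℝ) +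
          ε * (((X 2 c' i : ℚ) : ℝ) * ((W c i : ℚ) : ℝ)) := by
      intro i; rw [hX0 i c', hX1 i c', hX2 i c']; field_simp
    simp_rw [e1, Finset.sum_add_distrib, ← Finset.sum_div, hw0, zero_div, zero_add, ← Finset.mul_sum]
  · -- non-free × free
    simp only [hc, hc', if_true, if_false, Bool.false_eq_true, pL, pR1, pR2, Rat.cast_zero, mul_zero, add_zero]
    have e0 : ∀ k, (∑ i, (if i = c then (1 : ℝ) else 0) * (((X 0 i k : ℚ) : ℝ) + ε * ((X 1 i k : ℚ) : ℝ) + ε ^ 2 * ((X 2 i k : ℚ) : ℝ))) =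
        ((X 0 c k : ℚ) : ℝ) + ε * ((X 1 c k : ℚ) : ℝ) + ε ^ 2 * ((X 2 c k : ℚ) : ℝ) := by
      intro k; rw [Finset.sum_eq_single_of_mem c (Finset.mem_univ _) (fun i _ hi => by simp [hi])]
      simp
    simp_rw [e0]
    rw [exw, exw]
    have hw0 : ∑ k, ((X 0 c k : ℚ) : ℝ) * ((W c' k : ℚ) : ℝ) = 0 := by rw [← exw]; exact_mod_cast h0 c' c hc'
    have e1 : ∀ k, (((X 0 c k : ℚ) : ℝ) + ε * ((X 1 c k : ℚ) : ℝ) + ε ^ 2 * ((X 2 c k : ℚ) : ℝ)) * (((W c' k : ℚ) : ℝ) / ε) =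
        (((X 0 c k : ℚ) : ℝ) * ((W c' k : ℚ) : ℝ)) / ε + ((X 1 c k : ℚ) : ℝ) * ((W c' k : ℚ) : ℝ) +
          ε * (((X 2 c k : ℚ) : ℝ) * ((W c' k : ℚ) : ℝ)) := by
      intro k; field_simp
    simp_rw [e1, Finset.sum_add_distrib, ← Finset.sum_div, hw0, zero_div, zero_add, ← Finset.mul_sum]
  · -- non-free × non-free: the entry of X(ε) itself
    simp only [hc, hc', if_false, Bool.false_eq_true, pL, pR1, pR2]
    have e0 : ∀ k, (∑ i, (if i = c then (1 : ℝ) else 0) * (((X 0 i k : ℚ) : ℝ) + ε * ((X 1 i k : ℚ) : ℝ) + ε ^ 2 * ((X 2 i k : ℚ) : ℝ))) =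
        ((X 0 c k : ℚ) : ℝ) + ε * ((X 1 c k : ℚ) : ℝ) + ε ^ 2 * ((X 2 c k : ℚ) : ℝ) := by
      intro k; rw [Finset.sum_eq_single_of_mem c (Finset.mem_univ _) (fun i _ hi => by simp [hi])]
      simp
    simp_rw [e0]
    rw [Finset.sum_eq_single_of_mem c' (Finset.mem_univ _) (fun k _ hk => by simp [hk])]
    simp

/-! ## §4 The block theorem -/

/-- **THE STRUCTURED BLOCK THEOREM.** Data: tables `X₀, X₁, X₂`, the free-coordinate mask `fr`, kernel columns `W` (identity
pattern on free coordinates), the live mask `π`, a margin `μ`, row-sum bounds `ρ₁, ρ₂`, and an INTEGER rounded Gram certificate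
`(A, dg, B)` of `c·(L − μΠ)` (`A = c • (L − μΠ)` entrywise, `c > 0`). Kernel-decidable hypotheses: polynomiality, symmetry, dead
rows, row sums, the Gram residual's diagonal dominance (`IsGramCertZ`, row-splittable). Conclusion: `X(ε) ⪰ 0` for every
`0 < ε ≤ 1` with `ε·(ρ₁ + ρ₂) ≤ μ`. -/
theorem realXQ_posSemidef (X : Fin 3 → Fin d → Fin d → ℚ) (fr : Fin d → Bool) (W : Fin d → Fin d → ℚ) (π : Fin d → Bool)
    (μ ρ1 ρ2 : ℚ) {m : ℕ} (A : Matrix (Fin d) (Fin d) ℤ) (dg : Fin m → ℕ) (B : Matrix (Fin m) (Fin d) ℤ) (c : ℚ)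
    (hW : ∀ a a', fr a = true → fr a' = true → W a a' = if a = a' then 1 else 0)
    (h0 : ∀ a i, fr a = true → xw (X 0) W a i = 0) (h1 : ∀ a a', fr a = true → fr a' = true → wxw (X 1) W a a' = 0)
    (hX0 : ∀ i k, X 0 i k = X 0 k i) (hX1 : ∀ i k, X 1 i k = X 1 k i) (hX2 : ∀ i k, X 2 i k = X 2 k i)
    (hgram : IsGramCertZ A dg B) (hc : 0 < c)
    (hA : ∀ i i', (A i i' : ℚ) = c * (pL X fr W i i' - (if i = i' ∧ π i then μ else 0)))
    (hdead : ∀ i i', π i = false → pR1 X fr W i i' = 0 ∧ pR1 X fr W i' i = 0 ∧ pR2 X fr i i' = 0 ∧ pR2 X fr i' i = 0)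
    (hρ1 : ∀ i, ∑ i', |pR1 X fr W i i'| ≤ ρ1) (hρ2 : ∀ i, ∑ i', |pR2 X fr i i'| ≤ ρ2)
    {ε : ℝ} (hε0 : 0 < ε) (hε1 : ε ≤ 1) (hεμ : ε * ((ρ1 + ρ2 : ℚ) : ℝ) ≤ (μ : ℝ)) :
    (realXQ X ε).PosSemidef := by
  have hεne : ε ≠ 0 := hε0.ne'
  -- (1) the margin: real(L) − μ·Π ⪰ 0 from the integer rounded Gram certificate
  set PdM : Matrix (Fin d) (Fin d) ℝ := Matrix.diagonal (fun i => if π i then (1 : ℝ) else 0) with hPdM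
  have hL : (realQ (pL X fr W) - (μ : ℝ) • PdM).PosSemidef := by
    have h := hgram.posSemidef_of_smul (R := ℝ) hc hA
    have e : (Matrix.map (fun i i' => pL X fr W i i' - (if i = i' ∧ π i then μ else 0)) (Rat.cast : ℚ → ℝ)) =
        realQ (pL X fr W) - (μ : ℝ) • PdM := by
      ext i i'
      simp only [Matrix.map_apply, Matrix.sub_apply, Matrix.smul_apply, realQ, Matrix.of_apply, hPdM, Matrix.diagonal_apply,
        smul_eq_mul, Rat.cast_sub]
      by_cases h1 : i = i'
      · subst h1; by_cases h2 : π i <;> simp [h2]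
      · simp [h1]
    rwa [e] at h
  -- (2) the pencil P(ε) = L + (ε R₁ + ε² R₂) ⪰ 0 by the masked dominant lemma
  have hsymL : ∀ i i', pL X fr W i i' = pL X fr W i' i := by
    intro i i'
    have h1 := hA i i'; have h2 := hA i' i
    have h3 : A i' i = A i i' := hgram.isSymm.apply i i'
    rw [h3, h1] at h2
    have h4 := mul_left_cancel₀ hc.ne' h2
    -- the Π parts agree
    by_cases hii : i = i'
    · subst hii; rfl
    · have hne : ¬ i' = i := fun h => hii h.symm
      simp only [hii, hne, false_and, if_false, sub_zero] at h4
      exact h4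
  have hsymR1 : ∀ i i', pR1 X fr W i i' = pR1 X fr W i' i := by
    intro i i'; unfold pR1
    by_cases hi : fr i <;> by_cases hi' : fr i' <;> simp [hi, hi', hX1 i i']
  have hsymR2 : ∀ i i', pR2 X fr i i' = pR2 X fr i' i := by
    intro i i'; unfold pR2
    by_cases hi : fr i <;> by_cases hi' : fr i' <;> simp [hi, hi', hX2 i i']
  have hP : (realQ (pL X fr W) + (ε • realQ (pR1 X fr W) + ε ^ 2 • realQ (pR2 X fr))).PosSemidef := by
    refine posSemidef_of_dominant_mask _ _ (μ : ℝ) π hL ?_ ?_ ?_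
    · -- symmetry
      refine Matrix.IsSymm.ext fun i i' => ?_
      simp only [Matrix.add_apply, Matrix.smul_apply, realQ, Matrix.of_apply, smul_eq_mul, hsymR1 i i', hsymR2 i i']
    · -- dead rows
      intro i i' hi
      obtain ⟨a1, a2, a3, a4⟩ := hdead i i' hi
      constructor <;> simp only [Matrix.add_apply, Matrix.smul_apply, realQ, Matrix.of_apply, smul_eq_mul, a1, a2, a3, a4] <;> simp
    · -- row sums ≤ ε ρ₁ + ε² ρ₂ ≤ ε (ρ₁ + ρ₂) ≤ μ
      intro i
      have hr1 : ∑ i', |((pR1 X fr W i i' : ℚ) : ℝ)| ≤ (ρ1 : ℝ) := by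
        have := hρ1 i; exact_mod_cast this
      have hr2 : ∑ i', |((pR2 X fr i i' : ℚ) : ℝ)| ≤ (ρ2 : ℝ) := by
        have := hρ2 i; exact_mod_cast this
      have hρ2nn : (0 : ℝ) ≤ (ρ2 : ℝ) := le_trans (Finset.sum_nonneg fun i' _ => abs_nonneg _) hr2
      calc ∑ i', |(ε • realQ (pR1 X fr W) + ε ^ 2 • realQ (pR2 X fr)) i i'|
          ≤ ∑ i', (ε * |((pR1 X fr W i i' : ℚ) : ℝ)| + ε ^ 2 * |((pR2 X fr i i' : ℚ) : ℝ)|) := by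
            refine Finset.sum_le_sum fun i' _ => ?_
            simp only [Matrix.add_apply, Matrix.smul_apply, realQ, Matrix.of_apply, smul_eq_mul]
            have ha : |ε * ((pR1 X fr W i i' : ℚ) : ℝ)| = ε * |((pR1 X fr W i i' : ℚ) : ℝ)| := by
              rw [abs_mul, abs_of_pos hε0]
            have hb : |ε ^ 2 * ((pR2 X fr i i' : ℚ) : ℝ)| = ε ^ 2 * |((pR2 X fr i i' : ℚ) : ℝ)| := by
              rw [abs_mul, abs_of_nonneg (pow_nonneg hε0.le 2)]
            calc |ε * ((pR1 X fr W i i' : ℚ) : ℝ) + ε ^ 2 * ((pR2 X fr i i' : ℚ) : ℝ)|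
                ≤ |ε * ((pR1 X fr W i i' : ℚ) : ℝ)| + |ε ^ 2 * ((pR2 X fr i i' : ℚ) : ℝ)| := abs_add_le _ _
              _ = ε * |((pR1 X fr W i i' : ℚ) : ℝ)| + ε ^ 2 * |((pR2 X fr i i' : ℚ) : ℝ)| := by rw [ha, hb]
        _ = ε * ∑ i', |((pR1 X fr W i i' : ℚ) : ℝ)| + ε ^ 2 * ∑ i', |((pR2 X fr i i' : ℚ) : ℝ)| := by
            rw [Finset.sum_add_distrib, Finset.mul_sum, Finset.mul_sum]
        _ ≤ ε * (ρ1 : ℝ) + ε ^ 2 * (ρ2 : ℝ) := by gcongr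
        _ ≤ ε * (ρ1 : ℝ) + ε * (ρ2 : ℝ) := by
            have hε2 : ε ^ 2 ≤ ε := by nlinarith
            have := mul_le_mul_of_nonneg_right hε2 hρ2nn
            linarith
        _ = ε * ((ρ1 + ρ2 : ℚ) : ℝ) := by push_cast; ring
        _ ≤ (μ : ℝ) := hεμ
  -- (3) X(ε) = Sᵀ P(ε) S with S = T(ε)⁻¹
  have hTS : tMat fr W ε * sMat fr W ε = 1 := tMat_mul_sMat fr W hW hεne
  have hcong := congruence_eq X fr W h0 h1 hX0 hX1 hX2 hεne
  have hX : realXQ X ε = (sMat fr W ε)ᵀ * (realQ (pL X fr W) + (ε • realQ (pR1 X fr W) + ε ^ 2 • realQ (pR2 X fr))) * sMat fr W ε := by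
    rw [← add_assoc, ← hcong]
    -- Sᵀ (Tᵀ X T) S = (T S)ᵀ X (T S) = X
    have e : (sMat fr W ε)ᵀ * ((tMat fr W ε)ᵀ * realXQ X ε * tMat fr W ε) * sMat fr W ε =
        (tMat fr W ε * sMat fr W ε)ᵀ * realXQ X ε * (tMat fr W ε * sMat fr W ε) := by
      rw [Matrix.transpose_mul]; simp only [Matrix.mul_assoc]
    rw [e, hTS, Matrix.transpose_one, Matrix.one_mul, Matrix.mul_one]
  rw [hX]
  have h := hP.conjTranspose_mul_mul_same (sMat fr W ε)
  rwa [Matrix.conjTranspose_eq_transpose_of_trivial] at h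

/-! ## §5 Appended (rdm-B gen 42, same day): symmetry comes for free — the Gram certificate from its ROW inequalities only -/

/-- `wᵀX w'` is symmetric in `(w, w')` for symmetric `X`. -/
theorem wxw_symm (X : Fin d → Fin d → ℚ) (W : Fin d → Fin d → ℚ) (hX : ∀ i k, X i k = X k i) (a a' : Fin d) :
    wxw X W a a' = wxw X W a' a := by
  simp only [wxw, xw, Finset.mul_sum]
  rw [Finset.sum_comm]
  refine Finset.sum_congr rfl fun i _ => Finset.sum_congr rfl fun k _ => ?_
  rw [hX k i]; ring

/-- The pencil's constant term `L` is symmetric (from the symmetry of `X₀` and `X₂`; the mixed branches are symmetric by definition). -/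
theorem pL_symm (X : Fin 3 → Fin d → Fin d → ℚ) (fr : Fin d → Bool) (W : Fin d → Fin d → ℚ)
    (hX0 : ∀ i k, X 0 i k = X 0 k i) (hX2 : ∀ i k, X 2 i k = X 2 k i) (i i' : Fin d) :
    pL X fr W i i' = pL X fr W i' i := by
  unfold pL
  by_cases hi : fr i <;> by_cases hi' : fr i' <;> simp [hi, hi', hX0 i i', wxw_symm (X 2) W hX2 i i']

/-- An integer matrix tied to `c·(L − μΠ)` entrywise is symmetric. -/
theorem symm_of_hA (X : Fin 3 → Fin d → Fin d → ℚ) (fr : Fin d → Bool) (W : Fin d → Fin d → ℚ) (π : Fin d → Bool) (μ c : ℚ)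
    (hX0 : ∀ i k, X 0 i k = X 0 k i) (hX2 : ∀ i k, X 2 i k = X 2 k i) (A : Matrix (Fin d) (Fin d) ℤ)
    (hA : ∀ i i', (A i i' : ℚ) = c * (pL X fr W i i' - (if i = i' ∧ π i then μ else 0))) (i j : Fin d) : A i j = A j i := by
  have h1 := hA i j
  have h2 := hA j i
  rw [pL_symm X fr W hX0 hX2 j i] at h2
  have e : (if j = i ∧ π j then μ else 0) = (if i = j ∧ π i then μ else 0) := by
    by_cases hij : i = j
    · subst hij; rfl
    · have hji : ¬ j = i := fun h => hij h.symm
      simp [hij, hji]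
  rw [e, ← h1] at h2
  exact_mod_cast h2.symm

/-- **The integer rounded Gram certificate from its ROW inequalities alone** when `A` is known to be symmetric (the residual
`A − Bᵀ·diag d·B` is then symmetric identically) — halves the kernel work of `IsGramCertZ` for large blocks. -/
theorem isGramCertZ_of_rows {m : ℕ} (A : Matrix (Fin d) (Fin d) ℤ) (dg : Fin m → ℕ) (B : Matrix (Fin m) (Fin d) ℤ)
    (hAs : ∀ i j, A i j = A j i)
    (hr : ∀ i, ∑ j ∈ Finset.univ.erase i, |gramResidualZ A dg B i j| ≤ gramResidualZ A dg B i i) : IsGramCertZ A dg B := by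
  refine IsDiagDominantZ.intro (fun i j => ?_) hr
  simp only [gramResidualZ, hAs i j]
  congr 1
  exact Finset.sum_congr rfl fun k _ => by ring

end PencilRat

end Summit.Ventures.CertifiedQuantumChemistry
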